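import Summits.CriticalPhenomena.CardyFormulaZ2.Theorems.CardyComplexConeParafermionToSLESixFamiliesDiamondTraceSideChart
import Summits.CriticalPhenomena.CardyFormulaZ2.Theorems.CardyComplexConeParafermionToSLESixFamiliesIicTouchPassage
import HarnessLib

/-!
# Side cells versus chain cells: every cell of the boundary layers of a straight side is within two corner
# observables of a chain cell (line `potential-darboux-picard-diamond`, S1‴ assembly, "cells-vs-chain")

Crux `ParafermionToSLESixFamilies` (stmt-CriticalPhenomena-11389), line `potential-darboux-picard-diamond`, stub
`stub_exactPotentialTracePh3` (S1‴). Clauses (DIR)/(LOW) of `ExactPotentialTracePh` speak about ALL side cells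
(`sideCells`: cells with centre within `3δ` of the segment), i.e. in the chart `(A, B) = (layerFn j, layerFn (j+1))` of
the side (last inside layer `n`) the inner faces with centre layer `A ∈ {n−4, …, n−1}`, while the landed chain sums
(`exactPair_chainSum_touchProb`, `exactPair_wiredChainSum_of_phase`) run along ONE layer of cells, the chain cells
`faceAt x j`, `A x = n − 2` (centre layer `n − 2`). This file bridges the two:

* `norm_cornerObs_le_one` — `‖cornerObs E δ v f‖ ≤ 1` (a corner is passed at most once);
* `norm_sub_le_two_of_common_corner` — two inner faces sharing a corner OFF both arcs carry face potentials at
  distance `≤ 2` (two exact-pair increments through the common corner);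
* `chart_cornerOff`, `chart_of_isCorner` — the four corners of a face of centre `(Lc, Bc)` sit at `(Lc ± 1, Bc)`,
  `(Lc, Bc ± 1)`;
* `centreLayer_le_of_isInnerFace`, `le_centreLayer_of_re_ctr` — an inner face in the bulk has centre layer `≤ n − 1`, a
  face with centre within `3δ` of the side line has centre layer `≥ n − 4`;
* `exists_chainCell_near` (registered, `--supports` the crux) — **cells-vs-chain**: in the bulk of a side, every inner
  face `g` with centre `(Lc, Bc)`, `n − 4 ≤ Lc ≤ n − 1`, admits a site `x` with `A x = n − 2`, `B x ∈ {Bc, Bc + 1}`,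
  `faceAt x j` inner and `‖Ψ g − Ψ (faceAt x j)‖ ≤ 2` for every exact pair (the four cases `Lc = n−1, n−2, n−3, n−4`:
  through the min corner, itself, through the max corner, through the max corner into `faceAt · (j+1)`).

Pure lattice statements; nothing cited.
-/

noncomputable section

namespace Summit.CriticalPhenomena.CardyFormulaZ2.Cruxes.ParafermionToSLESixFamilies.PotentialDarbouxPicardDiamond

open Set Metric Complex MeasureTheory
open Literature.Probability Literature.Probability.LatticeModels Literature.Probability.Percolation
open Literature.Probability.LatticeModels.DiscreteDobrushin
open Literature.Probability.RandomPlanarGeometry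
open Summit.CriticalPhenomena.CardyFormulaZ2.Cruxes.EdgePrecompact.QkzStripBoundaryArm (cornerObs)
open Summit.CriticalPhenomena.CardyFormulaZ2.Cruxes.ParafermionToSLESixFamilies.IicTraceFluxPairing
  (norm_cornerObs_le_real_passesCorner)

/-! ## The corner observable is bounded by one; the gap across a common corner -/

/-- **`‖cornerObs E δ v f‖ ≤ 1`** for admissible data: the corner `(v, f)` is passed at most once, with a unimodular
phase. -/
theorem norm_cornerObs_le_one {E : DiscreteDobrushin} (hE : E.IsZdAdmissible) (δ : ℝ) {v f : Site 2}
    (hvf : IsCorner v f) : ‖cornerObs E δ v f‖ ≤ 1 :=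
  (norm_cornerObs_le_real_passesCorner hE δ hvf).trans measureReal_le_one

/-- **Two inner faces sharing a corner off both arcs carry potentials at distance at most `2`.** -/
theorem norm_sub_le_two_of_common_corner {E : DiscreteDobrushin} (hE : E.IsZdAdmissible) {δ : ℝ} {Φ Ψ : Site 2 → ℂ}
    (hP : IsExactPair E δ Φ Ψ) {v g h : Site 2} (hg : E.IsInnerFace g) (hh : E.IsInnerFace h) (hvg : IsCorner v g)
    (hvh : IsCorner v h) (hvA : v ∉ E.zdArcA) (hvB : v ∉ E.zdArcB) : ‖Ψ g - Ψ h‖ ≤ 2 := by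
  have eg := hP v g hvg hg hvA hvB
  have eh := hP v h hvh hh hvA hvB
  have hsub : Ψ g - Ψ h = classWeight (h - v) * cornerObs E δ v h - classWeight (g - v) * cornerObs E δ v g := by
    linear_combination eh - eg
  rw [hsub]
  refine (norm_sub_le _ _).trans ?_
  rw [norm_mul, norm_mul, norm_classWeight_of_isCorner hvh, norm_classWeight_of_isCorner hvg, one_mul, one_mul]
  linarith [norm_cornerObs_le_one hE δ hvg, norm_cornerObs_le_one hE δ hvh]

/-! ## The corners of a face in the chart -/

/-- The along-coordinates of the four corner offsets: `layerFn (j+1) (cornerOff (j+m)) = layerTop (j+1) − (0,1,2,1)ₘ`. -/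
theorem layerFn_succ_cornerOff (j m : Fin 4) : layerFn (j + 1) (cornerOff (j + m)) = layerTop (j + 1) - ![0, 1, 2, 1] m := by
  revert j m; decide

/-- **The corner `g + cornerOff (j+m)` of the face `g` in the chart**: with centre `(Lc, Bc)`,
`Lc = layerFn j g + layerTop j − 1`, `Bc = layerFn (j+1) g + layerTop (j+1) − 1`, it sits at
`(Lc + 1 − faceRise m, Bc + 1 − (0,1,2,1)ₘ)`, and `g = faceAt (g + cornerOff (j+m)) (j+m)`. -/
theorem chart_cornerOff (j m : Fin 4) (g : Site 2) :
    layerFn j (g + cornerOff (j + m)) = layerFn j g + layerTop j - faceRise m ∧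
      layerFn (j + 1) (g + cornerOff (j + m)) = layerFn (j + 1) g + layerTop (j + 1) - ![0, 1, 2, 1] m ∧
      faceAt (g + cornerOff (j + m)) (j + m) = g := by
  refine ⟨?_, ?_, by simp [faceAt]⟩
  · rw [layerFn_add]; have := layerTop_sub_layerFn_cornerOff j m; linarith
  · rw [layerFn_add, layerFn_succ_cornerOff]; ring

/-- **Every corner of a face is chart-adjacent to its centre**: `|A v − Lc| ≤ 1`, `|B v − Bc| ≤ 1`, and
`|A v − Lc| + |B v − Bc| = 1`. -/
theorem chart_of_isCorner (j : Fin 4) {v g : Site 2} (hv : IsCorner v g) :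
    |layerFn j v - (layerFn j g + layerTop j - 1)| + |layerFn (j + 1) v - (layerFn (j + 1) g + layerTop (j + 1) - 1)| = 1 := by
  obtain ⟨k, hk⟩ := exists_faceAt_of_isCorner hv
  obtain ⟨m, rfl⟩ := exists_eq_add j k
  have hvg : v = g + cornerOff (j + m) := by rw [hk, faceAt]; abel
  obtain ⟨hA, hB, -⟩ := chart_cornerOff j m g
  rw [hvg, hA, hB]
  fin_cases m <;> simp [faceRise]

/-! ## The layers of the cells near a side -/

section Frame

variable {c e : ℂ} (he : ‖e‖ = 1) {α β δ : ℝ} (hδ : 0 < δ) {E : DiscreteDobrushin}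
  (hΩ : E.Ω = {z : ℂ | |((z - c) * e).re| < α ∧ |((z - c) * e).im| < β}) (hEδ : E.δ = δ)
  (hgood : ∀ x : Site 2, meshPoint δ x ∈ E.Ω → x ∈ meshDomain E.Ω δ)
  {j : Fin 4} {X₀ : ℝ} (hX : ∀ x : Site 2, ((meshPoint δ x - c) * e).re = Real.sqrt 2 / 2 * δ * layerFn j x + X₀)
  {n : ℤ} (hn : Real.sqrt 2 / 2 * δ * n + X₀ < α) (hn' : α ≤ Real.sqrt 2 / 2 * δ * (n + 1) + X₀)
  {g : Site 2}
  (hbulk : ∀ v : Site 2, IsCorner v g →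
    |((meshPoint δ v - c) * e).im| + 3 * δ < β ∧ -α + 3 * δ < ((meshPoint δ v - c) * e).re)

include he hδ hΩ hEδ hX hn hn' hbulk in
/-- **An inner face in the bulk has centre layer at most `n − 1`** (its highest corner is inside). -/
theorem centreLayer_le_of_isInnerFace (hg : E.IsInnerFace g) : layerFn j g + layerTop j - 1 ≤ n - 1 := by
  obtain ⟨hA, -, hface⟩ := chart_cornerOff j 3 g
  have hc : IsCorner (g + cornerOff (j + 3)) g := by
    conv_rhs => rw [← hface]
    exact isCorner_faceAt _ _
  have hmem := corner_mem_of_isInnerFace hg hc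
  rw [hEδ] at hmem
  obtain ⟨hY, hXb⟩ := hbulk _ hc
  have := (mem_carrier_iff_layerFn_le_self he hδ hΩ hX hn hn' hY hXb).1 hmem
  rw [hA] at this
  simp [faceRise] at this
  linarith

include hδ hX hn in
/-- **A face whose centre is within `3δ` of the side line (from inside) has centre layer at least `n − 4`.** -/
theorem le_centreLayer_of_re_ctr (hre : α - 3 * δ ≤ ((ctr δ g - c) * e).re) : n - 4 ≤ layerFn j g + layerTop j - 1 := by
  rw [re_tilt_ctr hX] at hre
  have hs2 : (1.4 : ℝ) < Real.sqrt 2 := by rw [Real.lt_sqrt (by norm_num)]; norm_num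
  have hs2δ : 1.4 * δ < Real.sqrt 2 * δ := mul_lt_mul_of_pos_right hs2 hδ
  by_contra hlt
  push Not at hlt
  have hle : ((layerFn j g : ℤ) : ℝ) + (layerTop j : ℤ) - 1 ≤ (n : ℝ) - 5 := by
    exact_mod_cast (show layerFn j g + layerTop j - 1 ≤ n - 5 by omega)
  have hmul : Real.sqrt 2 / 2 * δ * (((layerFn j g : ℤ) : ℝ) + (layerTop j : ℤ) - 1) ≤ Real.sqrt 2 / 2 * δ * ((n : ℝ) - 5) :=
    mul_le_mul_of_nonneg_left hle (by positivity)
  linarith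

/-- `faceRise 0 = 1`, `faceRise 1 = 2`. -/
theorem faceRise_zero_one : faceRise 0 = 1 ∧ faceRise 1 = 2 := by decide

include he hδ hΩ hEδ hgood hX hn hn' hbulk in
/-- **Cells versus chain cells.** In the bulk of a side, every inner face `g` with centre `(Lc, Bc)` in the chart and
`n − 4 ≤ Lc ≤ n − 1` admits a site `x` on the chain layer `A x = n − 2` with `B x ∈ {Bc, Bc + 1}`, `faceAt x j` inner,
and `‖Ψ g − Ψ (faceAt x j)‖ ≤ 2` for every exact pair `(Φ, Ψ)` of `E` at any mesh. -/
theorem exists_chainCell_near' (hE : E.IsZdAdmissible) (hg : E.IsInnerFace g) (hLc : n - 4 ≤ layerFn j g + layerTop j - 1)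
    {δ' : ℝ} {Φ Ψ : Site 2 → ℂ} (hP : IsExactPair E δ' Φ Ψ) :
    ∃ x : Site 2, layerFn j x = n - 2 ∧
      (layerFn (j + 1) x = layerFn (j + 1) g + layerTop (j + 1) - 1 ∨
        layerFn (j + 1) x = layerFn (j + 1) g + layerTop (j + 1) - 1 + 1) ∧
      E.IsInnerFace (faceAt x j) ∧ ‖Ψ g - Ψ (faceAt x j)‖ ≤ 2 := by
  have hLc' := centreLayer_le_of_isInnerFace he hδ hΩ hEδ hX hn hn' hbulk hg
  -- the corner `v m = g + cornerOff (j + m)` and the lattice facts around it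
  have corner : ∀ m : Fin 4, IsCorner (g + cornerOff (j + m)) g := fun m => by
    obtain ⟨-, -, hface⟩ := chart_cornerOff j m g
    conv_rhs => rw [← hface]
    exact isCorner_faceAt _ _
  have face : ∀ m m' : Fin 4, layerFn j (g + cornerOff (j + m)) + faceRise m' ≤ n →
      E.IsInnerFace (faceAt (g + cornerOff (j + m)) (j + m')) := fun m m' h =>
    (isInnerFace_faceAt_iff_layerFn he hδ hΩ hEδ hgood hX hn hn' (hbulk _ (corner m)).1 (hbulk _ (corner m)).2 m').2 h
  have offArcs : ∀ m : Fin 4, layerFn j (g + cornerOff (j + m)) ≤ n - 2 →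
      g + cornerOff (j + m) ∉ E.zdArcA ∧ g + cornerOff (j + m) ∉ E.zdArcB := by
    intro m hm
    have hin : meshPoint δ (g + cornerOff (j + m)) ∈ E.Ω :=
      (mem_carrier_iff_layerFn_le_self he hδ hΩ hX hn hn' (hbulk _ (corner m)).1 (hbulk _ (corner m)).2).2 (by omega)
    have hnot : g + cornerOff (j + m) ∉ E.zdBoundary := fun hb => by
      have := (mem_zdBoundary_iff_layerFn' he hδ hΩ hEδ hgood hX hn hn' (hbulk _ (corner m)).1
        (hbulk _ (corner m)).2 hin).1 hb
      omega
    exact ⟨fun h => hnot (E.zdArcA_subset_zdBoundary h), fun h => hnot (E.zdArcB_subset_zdBoundary h)⟩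
  -- the four cases
  obtain ⟨hA1, hB1, hf1⟩ := chart_cornerOff j 1 g
  obtain ⟨hA0, hB0, hf0⟩ := chart_cornerOff j 0 g
  obtain ⟨hA3, hB3, hf3⟩ := chart_cornerOff j 3 g
  simp only [faceRise, Matrix.cons_val_one, Matrix.cons_val_zero, Matrix.cons_val] at hA1 hB1 hA0 hB0 hA3 hB3
  rcases (show layerFn j g + layerTop j - 1 = n - 1 ∨ layerFn j g + layerTop j - 1 = n - 2 ∨
      layerFn j g + layerTop j - 1 = n - 3 ∨ layerFn j g + layerTop j - 1 = n - 4 by omega) with h | h | h | h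
  · -- `Lc = n − 1`: through the min corner `v₁`, into `faceAt v₁ j`
    have hh : E.IsInnerFace (faceAt (g + cornerOff (j + 1)) j) := by
      have := face 1 0 (by rw [hA1, faceRise_zero_one.1]; omega); simpa using this
    obtain ⟨hvA, hvB⟩ := offArcs 1 (by rw [hA1]; omega)
    exact ⟨g + cornerOff (j + 1), by rw [hA1]; omega, Or.inl (by rw [hB1]), hh,
      norm_sub_le_two_of_common_corner hE hP hg hh (corner 1) (isCorner_faceAt _ _) hvA hvB⟩
  · -- `Lc = n − 2`: `g` is the chain cell `faceAt v₀ j`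
    rw [add_zero] at hA0 hB0 hf0
    refine ⟨g + cornerOff j, by rw [hA0]; omega, Or.inr (by rw [hB0]; ring), by rw [hf0]; exact hg, ?_⟩
    rw [hf0, sub_self, norm_zero]; norm_num
  · -- `Lc = n − 3`: through the max corner `v₃`, into `faceAt v₃ j`
    have hh : E.IsInnerFace (faceAt (g + cornerOff (j + 3)) j) := by
      have := face 3 0 (by rw [hA3, faceRise_zero_one.1]; omega); simpa using this
    obtain ⟨hvA, hvB⟩ := offArcs 3 (by rw [hA3]; omega)
    exact ⟨g + cornerOff (j + 3), by rw [hA3]; omega, Or.inl (by rw [hB3]), hh,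
      norm_sub_le_two_of_common_corner hE hP hg hh (corner 3) (isCorner_faceAt _ _) hvA hvB⟩
  · -- `Lc = n − 4`: through the max corner `v₃`, into `faceAt v₃ (j+1) = faceAt (v₃ − u_j) j`
    have hx : faceAt (g + cornerOff (j + 3) - cornerUnit j) j = faceAt (g + cornerOff (j + 3)) (j + 1) := by
      have := faceAt_add_unit_succ (g + cornerOff (j + 3) - cornerUnit j) j
      rw [sub_add_cancel] at this
      exact this.symm
    have hh : E.IsInnerFace (faceAt (g + cornerOff (j + 3)) (j + 1)) :=
      face 3 1 (by rw [hA3, faceRise_zero_one.2]; omega)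
    have hAu := layerFn_cornerUnit j 0
    have hBu := layerFn_succ_cornerUnit j 0
    simp only [add_zero, Matrix.cons_val_zero] at hAu hBu
    refine ⟨g + cornerOff (j + 3) - cornerUnit j, by rw [layerFn_sub, hA3, hAu]; omega,
      Or.inr (by rw [layerFn_sub, hB3, hBu]; ring), by rw [hx]; exact hh, ?_⟩
    rw [hx]
    obtain ⟨hvA, hvB⟩ := offArcs 3 (by rw [hA3]; omega)
    exact norm_sub_le_two_of_common_corner hE hP hg hh (corner 3) (isCorner_faceAt _ _) hvA hvB

end Frame

/-- **Cells versus chain cells** (registered helper of `stub_exactPotentialTracePh3`, frame form). For admissible data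
`E` on the open tilted rectangle `{|re((z−c)e)| < α, |im((z−c)e)| < β}` (`‖e‖ = 1`) read at its mesh `δ > 0`, every
lattice point of the rectangle in `Ω_δ`, tilted abscissa `(δ/√2)·layerFn j + X₀`, last inside layer `n`: every inner
face `g` whose corners are in the bulk of the side `re = α` and whose centre layer `layerFn j g + layerTop j − 1` is at
least `n − 4` admits a site `x` with `layerFn j x = n − 2`, `layerFn (j+1) x ∈ {Bc, Bc + 1}`
(`Bc = layerFn (j+1) g + layerTop (j+1) − 1`), `faceAt x j` inner and `‖Ψ g − Ψ (faceAt x j)‖ ≤ 2` for every exact pair. -/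
theorem exists_chainCell_near : ∀ (c e : ℂ), ‖e‖ = 1 → ∀ (α β δ : ℝ), 0 < δ → ∀ (E : DiscreteDobrushin), E.Ω = {z : ℂ | |((z - c) * e).re| < α ∧ |((z - c) * e).im| < β} → E.δ = δ → E.IsZdAdmissible → (∀ x : Site 2, meshPoint δ x ∈ E.Ω → x ∈ meshDomain E.Ω δ) → ∀ (j : Fin 4) (X₀ : ℝ), (∀ x : Site 2, ((meshPoint δ x - c) * e).re = Real.sqrt 2 / 2 * δ * layerFn j x + X₀) → ∀ (n : ℤ), Real.sqrt 2 / 2 * δ * n + X₀ < α → α ≤ Real.sqrt 2 / 2 * δ * (n + 1) + X₀ → ∀ g : Site 2, (∀ v : Site 2, IsCorner v g → |((meshPoint δ v - c) * e).im| + 3 * δ < β ∧ -α + 3 * δ < ((meshPoint δ v - c) * e).re) → E.IsInnerFace g → n - 4 ≤ layerFn j g + layerTop j - 1 → ∀ (δ' : ℝ) (Φ Ψ : Site 2 → ℂ), IsExactPair E δ' Φ Ψ → ∃ x : Site 2, layerFn j x = n - 2 ∧ (layerFn (j + 1) x = layerFn (j + 1) g + layerTop (j + 1) - 1 ∨ layerFn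 (j + 1) x = layerFn (j + 1) g + layerTop (j + 1) - 1 + 1) ∧ E.IsInnerFace (faceAt x j) ∧ ‖Ψ g - Ψ (faceAt x j)‖ ≤ 2 := by
  intro c e he α β δ hδ E hΩ hEδ hE hgood j X₀ hX n hn hn' g hbulk hg hLc δ' Φ Ψ hP
  exact exists_chainCell_near' he hδ hΩ hEδ hgood hX hn hn' hbulk hE hg hLc hP

end Summit.CriticalPhenomena.CardyFormulaZ2.Cruxes.ParafermionToSLESixFamilies.PotentialDarbouxPicardDiamond

end
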